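import Mathlib
import HarnessLib
import HarnessLib.Audit
import Summits.NavierStokesRegularity.Statement
import Literature.Analysis.FluidPDE.ClassicalSolution
import Literature.Analysis.FluidPDE.LerayHopf
import Literature.Analysis.FluidPDE.SuitableWeak
import Literature.Analysis.FluidPDE.VectorCalculus
import Literature.Analysis.FluidPDE.NSWave0
import Summits.NavierStokesRegularity.NavierStokesRegularity.Theorems.TypeICertificateLadderNoBlowupToClay
import HarnessLib.Audit.Status.Attr

/-!
Route: KelvinCirculationBudget

# Route KelvinCirculationBudget — Kelvin charge budget — critical signed vorticity charge of balls
is a-priori bounded and forces the Type-I rate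

X = CircBudget ∧ CircToTypeI ("it suffices to show X", given the shared residual NoTypeIBlowup =
stmt-NavierStokesRegularity-1217).
OBJECT: the SIGNED VORTICITY CHARGE of a ball, Q(x,r,t) := ∫_(B_r(x)) curl u(t) dy ∈ ℝ³ — by Stokes
the
average over parallel slices of the Kelvin circulations of the great circles of B_r(x); critical
gauge |Q| ≲ r
(invariant under u ↦ λu(λx,λ²t)); sign-indefinite, so cancellation is allowed to do work. CircBudget
(crux 2,
deciding): along every classical Leray–Hopf solution from a rapidly decaying datum on [0,T) there is
K with
|Q(x,r,t)| ≤ K·r for all x, all r ≤ 1, all t < T (a LARGE-constant a-priori budget, not a smallness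
statement). CircToTypeI (crux 3): a solution of that class obeying such a budget has the Type-I rate
‖u(t)‖_∞ ≤ C(T−t)^(-1/2) as t ↑ T. With NoTypeIBlowup (crux 4, shared, the declared residual: Type-I
rate ⇒
smooth extension past T) every such solution extends past every T, and the PROVED frame
typeICertificateLadder_noBlowupToClay_proof (stmt-0055) turns no-blow-up into Clay (A). Realises
sketch
mwave/kelvin-circulation-budget (reader PASS); no idea card.
Lean: `(∀ (ν T : ℝ), 0 < ν → 0 < T → ∀ (u : ℝ → EuclideanSpace ℝ (Fin 3) → EuclideanSpace ℝ (Fin 3))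
(p : ℝ → EuclideanSpace ℝ (Fin 3) → ℝ), Literature.Analysis.FluidPDE.IsClassicalNSSolutionOn
(Set.Ico 0 T) ν 0 u p → Literature.Analysis.FluidPDE.IsLerayHopfOn T ν 0 (u 0) u →
Literature.Analysis.FluidPDE.HasRapidSpatialDecay (u 0) → ∃ K : ℝ, ∀ t ∈ Set.Ico 0 T, ∀ (x :
EuclideanSpace ℝ (Fin 3)) (r : ℝ), 0 < r → r ≤ 1 → ‖∫ y in Metric.ball x r,
Literature.Analysis.FluidPDE.curl (u t) y‖ ≤ K * r) ∧ (∀ (ν T : ℝ), 0 < ν → 0 < T → ∀ (u : ℝ →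
EuclideanSpace ℝ (Fin 3) → EuclideanSpace ℝ (Fin 3)) (p : ℝ → EuclideanSpace ℝ (Fin 3) → ℝ),
Literature.Analysis.FluidPDE.IsClassicalNSSolutionOn (Set.Ico 0 T) ν 0 u p →
Literature.Analysis.FluidPDE.IsLerayHopfOn T ν 0 (u 0) u →
Literature.Analysis.FluidPDE.HasRapidSpatialDecay (u 0) → (∃ K : ℝ, ∀ t ∈ Set.Ico 0 T, ∀ (x :
EuclideanSpace ℝ (Fin 3)) (r : ℝ), 0 < r → r ≤ 1 → ‖∫ y in Metric.ball x r,
Literature.Analysis.FluidPDE.curl (u t) y‖ ≤ K * r) → Literature.Analysis.FluidPDE.IsTypeIBlowup u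
T)`

## Assembly
Pure logic, certified in Sketch.lean / glue.lean (theorem closes, lean check rc 0, 0 sorry): fix ν,
T, (u,p) classical on
[0,T), Leray–Hopf from a rapidly decaying datum; CircBudget gives K; CircToTypeI gives the Type-I
rate at T;
NoTypeIBlowup gives a smooth extension past T; this is the hypothesis `NoBlowup` of the PROVED tree
theorem
Summit.NavierStokesRegularity.NavierStokesRegularity.Theorems.typeICertificateLadder_noBlowupToClay_proof
(stmt-0055),
which returns NavierStokesRegularity. Deciding theorem (crux-only, every binder load-bearing):
`theorem closes (h₁ : CircBudget) (h₂ : CircToTypeI) (h₃ : NoTypeIBlowup) : NavierStokesRegularity`.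
No
Target item is filed (BC6: declared 4 / in-cone 4 / aside 0 expected). Conjunct attacked: "every
first
singularity is Type I" ⇐ CircBudget ∧ CircToTypeI; residual: NoTypeIBlowup. The Assembly item below
is
the same implication as a Prop; `closes` proves it inline (`have hA : Assembly := …`) and applies
it, so it is the
glue node of the cone, provable now by the identical three-line term.

Rationale: WHY THIS LINE. Change the currency of the a-priori estimate from energy (supercritical) to
CIRCULATION: Kelvin's theorem is
the one exact inviscid law that is critical, and its viscous, ball-averaged form dQ/dt = −∮(u·n)ω +
∮(ω·n)u +
ν∮(n·∇)ω (fluxes through ∂B_r only, because ∂_t ω = curl(u×ω) + νΔω is a curl) is a LOCAL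
CONSERVATION LAW
with no interior source — the structure Tao's averaged equations lack (arXiv:1402.0290 p.11 names
vortex-line
transport as the sign-indefinite obstacle to blow-up machines) and the structure Lei–Ren–Tian
(arXiv:2501.08976,
Lemma 3.1–3.2) already turn into Type-I bounds for the UNSIGNED flux under a double-cone hypothesis.
The line
imports: geometric/ideal fluid mechanics (Kelvin–Helmholtz, Constantin–Iyer's stochastic circulation
theorem
arXiv:math/0511067 Prop. 2.10, Eyink arXiv:0810.0817), ε-regularity in Morrey/charge form (in-tree
circulationFloor_proof = stmt-1538: charge ≤ 2c₀ν·ρ at small scales ⇒ no blow-up, via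
Cheskidov–Shvydkoy
arXiv:0708.3067 Lemma 3.2), and the Type-I programme (KNSS arXiv:0709.3599, Seregin–Šverák
arXiv:0804.1803,
Albritton–Barker arXiv:1811.00502) as the continuation. What it does that listed routes do not:
SlicedKelvin
bounds the UNSIGNED flux through every PLANE (a far stronger claim, which implies CircBudget) and
continues
rate-free through a Liouville theorem; TautLoopKelvin's non-collapse of quantum circles is
EQUIVALENT to no
blow-up given the floor; ThreadingFlux works on the Type-I-exclusion side with an unsigned radial
flux. Here the
budget is asked only at LARGE constant for the SIGNED, ball-averaged charge — strictly weaker than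
all three —
and the price is paid on the rate side (CircToTypeI), where Morrey-type Type-I technology exists.

RANKED CRUXES. #2 CircBudget (crux) — KELVIN CHARGE BUDGET (deciding crux). For every ν > 0, T > 0
and every classical solution (u,p) of unforced NS on ℝ³×[0,T) that is Leray–Hopf from a rapidly
decaying datum, there is K such that ‖∫_(B_r(x)) curl u(t)‖ ≤ K·r for all t ∈ [0,T), all x and all 0
< r ≤ 1. [difficulty: XL] (why it might fail: dQ/dt contains the stretching flux ∮(ω·n)u of free
sign; a Type-II focusing scenario (Hou arXiv:2107.06509-type, or Tao-style gates respecting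
sign-indefinite laws, arXiv:1402.0290 p.11) could pump |Q|/r → ∞ at one point with bounded energy;
no critical a-priori bound beyond energy is known.) [arXiv:2501.08976, arXiv:1402.0290,
arXiv:math/0511067, arXiv:0810.0817, arXiv:2107.06509,
Literature.Barriers.NavierStokesRegularity.EnergySupercriticality]
#3 CircToTypeI (crux) — CHARGE ⇒ TYPE-I RATE. A classical Leray–Hopf solution from a rapidly
decaying datum on [0,T) whose ball charges obey ‖∫_(B_r(x)) curl u(t)‖ ≤ K·r (all t < T, x, r ≤ 1)
satisfies ‖u(t)‖_∞ ≤ C(T−t)^(-1/2) for t ↑ T (IsTypeIBlowup u T; rate only, vacuous if u stays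
bounded). [difficulty: L] (why it might fail: a signed charge bound is kinematically compatible with
unbounded speed — N nested coaxial rings of radii 2^(-i), circulation Γ each, keep all ball charges
≤ CΓr yet give centre speed ≈ NΓ; the step must be dynamic (vorticity rate + unsigned density);
oscillatory Type-II furniture could defeat it.) [arXiv:2501.08976, arXiv:0804.1803,
arXiv:1811.00502, arXiv:1812.09115, arXiv:0708.3067, GigaMiyakawa1989]
#4 NoTypeIBlowup (crux) — TYPE-I EXCLUSION (shared verbatim with stmt-NavierStokesRegularity-1217 of
route TypeICertificateLadder; the declared RESIDUAL of this route). A classical Leray–Hopf solution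
from a rapidly decaying datum on [0,T) with the Type-I rate at T extends smoothly past T.
[difficulty: open-problem] (why it might fail: Type-I exclusion is open beyond axisymmetry (KNSS
2009, Seregin–Šverák 2009); the Liouville conjecture for bounded ancient mild solutions may fail,
and the tree's AveragedTypeIBlowup shows autonomy/estimate-only arguments cannot exclude the L∞
rate.) [arXiv:0709.3599, arXiv:0804.1803, arXiv:1811.00502,
Literature.Barriers.NavierStokesRegularity.AveragedTypeIBlowup,
Literature.Barriers.NavierStokesRegularity.AxisymmetricTypeIExclusion]

TWO-LAYER PLAN. Foreseen glued splits (nothing filed now; the registered birth skeletons carry them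
as stubs): CircBudget ⇐
TypeIEnvelopeCharge (|u| ≤ C/(|x−x₀|+√(T−t)) ⇒ |Q| ≤ 4πC·r by the Stokes identity Q = ∮_(∂B_r) n×u
dS; the BC5
rung) → BeyondEnvelopeCharge → CircBudget; CircToTypeI ⇐ VorticityRate (charge ⇒ ‖ω(t)‖_∞ ≲
(T−t)^(-1)) →
VelocityRateFromDensity (unsigned density ∫_(B_r)|ω| ≤ K'r + vorticity rate ⇒ Type I, Lei–Ren–Tian
Lemma 3.2 /
Seregin–Šverák) → VelocityRateWithCancellation → CircToTypeI. A tenure option for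
TypeICertificateLadder:
`--split NoTypeII --into CircBudget CircToTypeI` (reader's recommendation). NoTypeIBlowup is worked
on its own
routes (live line Cruxes/Target/Lines/depletion_ladder.lean).

KILL CRITERIA. ¬CircBudget exhibited on one classical Leray–Hopf solution (sup_(x, r≤1) |Q|/r
unbounded before some T — an exact
solution or a certified computation) closes the route `refuted:CircBudget`. ¬CircToTypeI (a
bounded-charge
solution without the Type-I rate, i.e. a Type-II singularity with tame charge) kills the hand-off:
pivot to
"charge budget ⇒ regularity" directly through De Giorgi smallness of the flux (Lei–Ren–Tian §4) or
retire.
NoTypeIBlowup refuted (a Type-I blow-up exists) is ¬Clay (A) outright and kills every regularity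
route. NoTypeII
(stmt-0056) or NoBlowup proved elsewhere moots cruxes 2–3; PlanarFluxAPriori (SlicedKelvin) proved
gives
CircBudget for free and the route contracts to CircToTypeI.

NOT DECOMPOSED YET. The mollified Kelvin–Stokes identity and the Newton shell bound behind the
envelope rung (layer-2 of CircBudget);
the beyond-envelope (genuinely Type-II) branch of CircBudget, which is the whole difficulty and has
no named tool
yet; the signed-to-unsigned passage inside CircToTypeI (density vs cancellation branches); constants
K(ν, E₀,
‖ω₀‖_(L¹)) — uniformity of K in the data is deliberately NOT claimed at open.

CHEAPEST FALSIFIER. Certified numerics (one kit job, not yet run — compute reserved for the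
refuter): track K(t) = sup_(x, r ≤ 1)
|∫_(B_r(x)) ω(t)|/r along (i) Hou's axisymmetric interior blow-up candidate (arXiv:2107.06509) and
(ii) the
Kida–Pelz / Taylor–Green high-symmetry runs; unbounded growth of K(t) toward the candidate singular
time kills
CircBudget in spirit, saturation supports it. In-Lean checks already run: BC2/BC7 probes (no cheap C
→ S, S → C,
vacuity or rigidity), BC4 (`exact?` finds no existing theorem/item for CircBudget or CircToTypeI).

NUMBERS. Critical gauge: |Q(x,r,t)| ≤ K r, dimension of K = velocity×length/length² … = circulation
per length (same as
ν). Lower companion, PROVED in tree (stmt-1538 circulationFloor_proof): blow-up at T ⇒ for every δ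
some circle of
radius ≤ δ carries |∮u·dl| ≥ c₀ν, equivalently charge smallness |∫_(B_ρ) ω·n| ≤ 2ρ·c₀ν at small
scales ⇒ no
blow-up (Cheskidov–Shvydkoy B^(-1)_(∞,∞) smallness). Envelope rung constant: |u| ≤ C/(|x−x₀|+√(T−t))
⇒ K = 4πC.
Lei–Ren–Tian: absolute disc flux ≤ G^(O(G)) under |ω| ≤ C|ω₃| + M, then Type I via Λ_q, 3/2 < q < 2
(Lemma 2.3,
3.1, 3.2). Type-I rate: ‖u(t)‖_∞ ≤ C(T−t)^(-1/2) (IsTypeIBlowup; Leray's lower bound is the matching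
rate).
Items at open: 4 (3 cruxes + assembly).

DEFINITION REQUESTS. None: curl, IsClassicalNSSolutionOn, IsLerayHopfOn, HasRapidSpatialDecay,
IsTypeIBlowup, HasSmoothExtensionPast
exist in Literature.Analysis.FluidPDE (lean search --decl each; Sketch.lean rc 0).

Novelty: Searches (2026-08-17): `lit search --hybrid "circulation vorticity integral ball a priori bound
Navier-Stokes critical"` (10 books, none on an a-priori charge bound); `lit vsearch "a priori bound
for the integral of the vorticity over every ball, linear in r, along NS solutions"` (10 books,
generic); `lit vsearch "stochastic Kelvin circulation theorem … backward martingale"` (8, generic);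
`lit search "Kelvin circulation Navier-Stokes regularity a priori" --kind paper` (local 1
irrelevant; crossref 12 generic; openalex/s2 rate-limited); `lit search "Constantin Iyer stochastic
Lagrangian …"` (8 local: arXiv:0810.0817, arXiv:1808.05308, …); `lit search "vorticity flux bound
blow-up Navier-Stokes Type I circulation" --kind paper` (12; HIT paper:arxiv-2501.08976); `lit
galaxy search "Kelvin circulation theorem|vorticity flux|stochastic Kelvin" --star all` (26 rows,
textbooks/geophysics, none on NS regularity); `lit galaxy search "absolute vorticity flux|flux of
vorticity|vorticity charge" --star pdf` (12, none relevant); `lit galaxy search "Type I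
blow|Liouville theorem for the Navier|bounded ancient" --star pdf` (6, none relevant); `lit frontier
NavierStokesRegularity --since 2024` (15 newest descendants, none on circulation budgets); `ledger
negatives --problem NavierStokesRegularity` (5, none about charge / Type-I rate); BC4 `exact?`
against Statement + all 80 Theses: no match for CircBudget, CircToTypeI.
Nearest prior art found: [corpus:paper:arxiv-2501.08976 pp.3–9] Lei–Ren–T  [refs: 0810.0817, 1808.05308, paper:arxiv-2501.08976, paper:arxiv-math_0511067, paper:arxiv-0810.0817, paper:arxiv-1402.0290]

Barriers (technique_class: kelvin-circulation, vorticity-flux, type-I-rate): - technique_class: kelvin-circulation, vorticity-flux, type-I-rate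
- Literature.Barriers.NavierStokesRegularity.EnergySupercriticality: CircBudget IS Tao's Strategy 2
(a new globally controlled CRITICAL quantity); the barrier records that none is known, not that none
exists (scope_caveats (i): "not formalised as a rigorous barrier"); the proved content
(Lemarié-Rieusset's degeneracy of Picard iteration in supercritical path spaces) does not quantify
over a signed, non-coercive critical functional that is never used as a Picard norm. Honest: the
beyond-envelope branch of CircBudget must beat supercriticality head-on with the Kelvin conservation
form; that is the bet.
- Literature.Barriers.NavierStokesRegularity.TaoAveragedBlowup: the budget is derived from the
vorticity-transport form ∂_t ω = curl(u×ω) + νΔω (charge changes only through boundary fluxes), a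
fine-structure property of B that a generic symmetric cancelling average B̃ does not have (no
vorticity equation, no Kelvin theorem); conceded (arXiv:1402.0290 p.11): sign-indefinite
conservation laws might be respected by blow-up gates, so evasion is by hypothesis-violation, not by
theorem.
- Literature.Barriers.NavierStokesRegularity.AveragedTypeIBlowup: CircToTypeI concludes the L∞ RATE
from a charge budget (it does not exclude Type I), so the barrier's target statement is not this
crux; NoTypeIBlowup sits squarely inside the barrier's target (Type-I exclusion at the L∞-rate tier)
and must use ESS backward uniqueness / sc

sub-problem: NavierStokesRegularity · status: draft · opened planner-type-a689932d38-0 2026-08-17T16:23:43Z · rev 0 · ledger route-NavierStokesRegularity-KelvinCirculationBudget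
GENERATED by the gate from the ledger (D-0016/17). Provers cite these decls: `theorem foo : Summit.NavierStokesRegularity.NavierStokesRegularity.Theses.KelvinCirculationBudget.<Decl> := …` in Summits/NavierStokesRegularity/NavierStokesRegularity/Theorems/<Name>.lean.
-/

namespace Summit.NavierStokesRegularity.NavierStokesRegularity.Theses.KelvinCirculationBudget

open scoped BigOperators Topology Manifold Classical MeasureTheory ProbabilityTheory Matrix InnerProductSpace ComplexConjugate ContinuousMap
open Filter Set Function TopologicalSpace MeasureTheory

attribute [summit_statement] _root_.NavierStokesRegularity

open Literature.NS

/-- item stmt-NavierStokesRegularity-18358 · crux · rank 2 · open · by planner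
why it might fail: dQ/dt contains the stretching flux ∮(ω·n)u of free sign; a Type-II focusing scenario (Hou arXiv:2107.06509-type, or Tao-style gates respecting sign-indefinite laws, arXiv:1402.0290 p.11) could pump |Q|/r → ∞ at one point with bounded energy; no critical a-priori bound beyond energy is known.
sources: arXiv:2501.08976, arXiv:1402.0290, arXiv:math/0511067, arXiv:0810.0817, arXiv:2107.06509, Literature.Barriers.NavierStokesRegularity.EnergySupercriticality
[crux] KELVIN CHARGE BUDGET (deciding crux). For every ν > 0, T > 0 and every classical solution
(u,p) of unforced NS on ℝ³×[0,T) that is Leray–Hopf from a rapidly decaying datum, there is K such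
that ‖∫_(B_r(x)) curl u(t)‖ ≤ K·r for all t ∈ [0,T), all x and all 0 < r ≤ 1. [difficulty: XL] -/
@[route_item "route-NavierStokesRegularity-KelvinCirculationBudget", crux]
def CircBudget : Prop :=
  ∀ (ν T : ℝ), 0 < ν → 0 < T → ∀ (u : ℝ → EuclideanSpace ℝ (Fin 3) → EuclideanSpace ℝ (Fin 3)) (p : ℝ → EuclideanSpace ℝ (Fin 3) → ℝ), Literature.Analysis.FluidPDE.IsClassicalNSSolutionOn (Set.Ico 0 T) ν 0 u p → Literature.Analysis.FluidPDE.IsLerayHopfOn T ν 0 (u 0) u → Literature.Analysis.FluidPDE.HasRapidSpatialDecay (u 0) → ∃ K : ℝ, ∀ t ∈ Set.Ico 0 T, ∀ (x : EuclideanSpace ℝ (Fin 3)) (r : ℝ), 0 < r → r ≤ 1 → ‖∫ y in Metric.ball x r, Literature.Analysis.FluidPDE.curl (u t) y‖ ≤ K * r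

/-- item stmt-NavierStokesRegularity-18359 · crux · rank 3 · open · by planner
why it might fail: a signed charge bound is kinematically compatible with unbounded speed — N nested coaxial rings of radii 2^(-i), circulation Γ each, keep all ball charges ≤ CΓr yet give centre speed ≈ NΓ; the step must be dynamic (vorticity rate + unsigned density); oscillatory Type-II furniture could defeat it.
sources: arXiv:2501.08976, arXiv:0804.1803, arXiv:1811.00502, arXiv:1812.09115, arXiv:0708.3067, GigaMiyakawa1989
[crux] CHARGE ⇒ TYPE-I RATE. A classical Leray–Hopf solution from a rapidly decaying datum on [0,T)
whose ball charges obey ‖∫_(B_r(x)) curl u(t)‖ ≤ K·r (all t < T, x, r ≤ 1) satisfies ‖u(t)‖_∞ ≤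
C(T−t)^(-1/2) for t ↑ T (IsTypeIBlowup u T; rate only, vacuous if u stays bounded). [difficulty: L] -/
@[route_item "route-NavierStokesRegularity-KelvinCirculationBudget", crux]
def CircToTypeI : Prop :=
  ∀ (ν T : ℝ), 0 < ν → 0 < T → ∀ (u : ℝ → EuclideanSpace ℝ (Fin 3) → EuclideanSpace ℝ (Fin 3)) (p : ℝ → EuclideanSpace ℝ (Fin 3) → ℝ), Literature.Analysis.FluidPDE.IsClassicalNSSolutionOn (Set.Ico 0 T) ν 0 u p → Literature.Analysis.FluidPDE.IsLerayHopfOn T ν 0 (u 0) u → Literature.Analysis.FluidPDE.HasRapidSpatialDecay (u 0) → (∃ K : ℝ, ∀ t ∈ Set.Ico 0 T, ∀ (x : EuclideanSpace ℝ (Fin 3)) (r : ℝ), 0 < r → r ≤ 1 → ‖∫ y in Metric.ball x r, Literature.Analysis.FluidPDE.curl (u t) y‖ ≤ K * r) → Literature.Analysis.FluidPDE.IsTypeIBlowup u T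

/-- item stmt-NavierStokesRegularity-1217 · crux · rank 4 · open · by planner
why it might fail: Type-I exclusion is open beyond axisymmetry (KNSS 2009, Seregin–Šverák 2009); the Liouville conjecture for bounded ancient mild solutions may fail, and the tree's AveragedTypeIBlowup shows autonomy/estimate-only arguments cannot exclude the L∞ rate.
sources: arXiv:0709.3599, arXiv:0804.1803, arXiv:1811.00502, Literature.Barriers.NavierStokesRegularity.AveragedTypeIBlowup, Literature.Barriers.NavierStokesRegularity.AxisymmetricTypeIExclusion
[target] X = NO TYPE-I BLOW-UP FOR CLAY DATA: a classical solution of unforced NS on ℝ³×[0,T) which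
is Leray–Hopf from a rapidly decaying datum and blows up at most at the Type-I rate ‖u(t)‖∞ ≤
C(T−t)^{-1/2} extends smoothly past T. Equals UnthreadedNoBlowup ∧ ThreadedNoBlowup by excluded
middle on 'every point is unthreaded' (proved in the planner's Sketch.lean: target_of_cruxes); it is
the unconditional conclusion of stmt-NavierStokesRegularity-0058 (route TypeILiouville, which
assumes (L)). With NoTypeII (stmt-0056) it gives NoBlowup (stmt-0054). Card:
threading-flux-trace-topology. -/
@[route_item "route-NavierStokesRegularity-KelvinCirculationBudget", crux]
def NoTypeIBlowup : Prop :=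
  ∀ (ν T : ℝ), 0 < ν → 0 < T → ∀ (u : ℝ → EuclideanSpace ℝ (Fin 3) → EuclideanSpace ℝ (Fin 3)) (p : ℝ → EuclideanSpace ℝ (Fin 3) → ℝ), Literature.Analysis.FluidPDE.IsClassicalNSSolutionOn (Set.Ico 0 T) ν 0 u p → Literature.Analysis.FluidPDE.IsLerayHopfOn T ν 0 (u 0) u → Literature.Analysis.FluidPDE.HasRapidSpatialDecay (u 0) → Literature.Analysis.FluidPDE.IsTypeIBlowup u T → Literature.Analysis.FluidPDE.HasSmoothExtensionPast ν 0 u T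

/-- item stmt-NavierStokesRegularity-18360 · assembly · rank 1 · closed · proved by Summit.NavierStokesRegularity.NavierStokesRegularity.Theorems.kelvinCirculationBudget_assembly_proof (prover) · by planner
sources: Fefferman2000, arXiv:0709.3599
[assembly] CircBudget → CircToTypeI → NoTypeIBlowup → NavierStokesRegularity (pure logic over the
proved frame typeICertificateLadder_noBlowupToClay_proof, stmt-0055). -/
@[route_item "route-NavierStokesRegularity-KelvinCirculationBudget"]
def Assembly : Prop :=
  CircBudget → CircToTypeI → NoTypeIBlowup → NavierStokesRegularity

-- `Assembly` holds: proved by `Summit.NavierStokesRegularity.NavierStokesRegularity.Theorems.kelvinCirculationBudget_assembly_proof` (its module imports this route file, so no `_holds` link can be stated here).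

/-! D-0027 §2.1 — DECIDING THEOREM (planner-authored via `route open/edit --closes-file`; by planner-type-a689932d38-0 2026-08-17T16:23:44Z):
its hypotheses are this route's items and its conclusion the sub-problem Statement (glue_lint), and it elaborates with this file. -/

@[closes "route-NavierStokesRegularity-KelvinCirculationBudget"] theorem closes (h₁ : CircBudget) (h₂ : CircToTypeI) (h₃ : NoTypeIBlowup) :
    NavierStokesRegularity := by
  have hA : Assembly := by
    intro k₁ k₂ k₃
    refine _root_.Summit.NavierStokesRegularity.NavierStokesRegularity.Theorems.typeICertificateLadder_noBlowupToClay_proof ?_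
    intro ν T hν hT u p hcl hLH hdec
    exact k₃ ν T hν hT u p hcl hLH hdec (k₂ ν T hν hT u p hcl hLH hdec (k₁ ν T hν hT u p hcl hLH hdec))
  exact hA h₁ h₂ h₃

end Summit.NavierStokesRegularity.NavierStokesRegularity.Theses.KelvinCirculationBudget
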